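import Literature.NumberTheory.GelbartRogawski1991.LocalUnitaryUndoubling
import Literature.RepresentationTheory.HeisenbergGroup.MetaplecticSumStrippingRightHom
import Literature.NumberTheory.Automorphic.UnitaryGroupFinAdelicCenterLocal
import Literature.NumberTheory.Automorphic.SmoothRepresentation
import HarnessLib

-- buildfix G11b-3 recipe (LEDGER B13-1/B13-3), as in the GelbartRogawski1991 siblings: elaborate sequentially so the
-- trailing `attribute [implicit_reducible]` block is in force at `.olean` export (inert for the kernel).
set_option Elab.async false

/-!
# Restriction of a local theta section of `U(V₁ ⊥ V₂)(F_v)` to the two blocks `U(V₁)(F_v)`, `U(V₂)(F_v)`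

Topic `NumberTheory/GelbartRogawski1991`; namespace `Literature.NumberTheory.GelbartRogawski1991.UnitaryDualPair.LocalSplitting`
(that of `LocalUnitarySplittingDatum` / `LocalUnitaryUndoubling`).  KERNEL MATHEMATICS ONLY: definitions with bodies +
theorems; no named fact, no `sorry`.  The tree's `LocalUnitaryUndoubling` (block decomposition `T₀ ⊕ (−T₀)` of the
DOUBLED group, left block only) generalised to an ARBITRARY orthogonal sum `T = T₁ ⊕ᶠ T₂ := UnitaryGroup.finSum n₁ n₂ T₁ T₂`
of symmetric Gram matrices over `F` (sizes `n₁ + n₂`) and to BOTH blocks: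

* §1 `inlLoc : U(J₁)(F_v) →* U(J)(F_v)` (`g ↦ g ⊕ 1`) and `inrLoc : U(J₂)(F_v) →* U(J)(F_v)` (`g ↦ 1 ⊕ g`), on the factor
  forms `localPi` (`Jᵢ = Tᵢ ⊗ 1`, `J = T ⊗ 1`); continuous, commuting (`inlLoc_mul_inrLoc_comm`);
* §2 **`ι_v(g ⊕ 1) = ι₁,v(g) ⊕ 1`**, **`ι_v(1 ⊕ g) = 1 ⊕ ι₂,v(g)`** (`iota_inlLoc`, `iota_inrLoc`: the embedding into
  `Sp(𝕎_v) = Sp(𝕎₁,v ⊕ 𝕎₂,v)` restricted to the blocks is the tree's `spInl` / `spInr` of the block embeddings);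
* §3 **block restrictions of a section**: for `s : U(J)(F_v) →* S̃p(𝕎_v)` over `ι_v`, `restrictLeft s : U(J₁)(F_v) →*
  S̃p(𝕎₁,v)` over `ι₁,v` and `restrictRight s : U(J₂)(F_v) →* S̃p(𝕎₂,v)` over `ι₂,v` (sum-stripping,
  `MetaplecticSumStripping.undouble` / `MetaplecticSumStrippingRightHom.undoubleRight`), with
  **`ω(s (g₁ ⊕ 1))(f₁ ⊠ f₂) = ω(restrictLeft s g₁) f₁ ⊠ f₂`**, **`ω(s (1 ⊕ g₂))(f₁ ⊠ f₂) = f₁ ⊠ ω(restrictRight s g₂) f₂`**,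
  hence `ω(s ((g₁ ⊕ 1)(1 ⊕ g₂)))(f₁ ⊠ f₂) = ω(restrictLeft s g₁) f₁ ⊠ ω(restrictRight s g₂) f₂` — the restriction of
  the oscillator representation of `U(V₁ ⊥ V₂)` to `U(V₁) × U(V₂)` is the outer tensor product of the two small
  oscillator representations ([MoeglinVignerasWaldspurger1987, Chap. 2 II.1 Rem. (6)]; [Kudla1984, §1] see-saw pairs);
* §4 smoothness transfers to both restrictions (`isSmooth_restrictLeft`, `isSmooth_restrictRight`);
* §5 the centre: `localCenter (n₁ + n₂) J z = inlLoc (localCenter n₁ J₁ z) · inrLoc (localCenter n₂ J₂ z)`.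

Consumer: route R for row IV-4c3 of the Hodge/COR-CM interface (U(L)-types of a rank-one theta lift through the
restriction to `U(H) × U(L)`, `V_v = H ⊥ L`).  HC_CM is NOT proved here.

## References
* [MoeglinVignerasWaldspurger1987] LNM 1291 (1987), Chap. 2 II.1 Rem. (6).
* [Kudla1984] S. Kudla, *Seesaw dual reductive pairs*, Progr. Math. 46 (1984), §1.
* [GelbartRogawski1991] S. Gelbart, J. Rogawski, Invent. Math. 105 (1991), §3.1 Prop. 3.1.1 p. 455 (undoubling).
-/

set_option autoImplicit false

noncomputable section

open NumberField IsDedekindDomain Matrix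
open Literature.RepresentationTheory.HeisenbergGroup
open Literature.NumberTheory.Automorphic Literature.NumberTheory.Weil1964

namespace Literature.NumberTheory.GelbartRogawski1991.UnitaryDualPair.LocalSplitting

namespace BlockSum

variable (F : Type) [Field F] [NumberField F] (E : Type) [Field E] [NumberField E] [Algebra F E] (c : E ≃ₐ[F] E)
  (v : HeightOneSpectrum (𝓞 F)) (n₁ n₂ : ℕ) {T₁ : Matrix (Fin n₁) (Fin n₁) F} {T₂ : Matrix (Fin n₂) (Fin n₂) F}
  {J₁ : Matrix (Fin n₁) (Fin n₁) E} (hJ₁ : J₁ = T₁.map (algebraMap F E))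
  {J₂ : Matrix (Fin n₂) (Fin n₂) E} (hJ₂ : J₂ = T₂.map (algebraMap F E))
  {J : Matrix (Fin (n₁ + n₂)) (Fin (n₁ + n₂)) E} (hJ : J = (UnitaryGroup.finSum n₁ n₂ T₁ T₂).map (algebraMap F E))

local notation "Fv" => v.adicCompletion F
/-- the concatenation `Fin n₁ ⊕ Fin n₂ ≃ Fin (n₁ + n₂)`. -/
local notation "eS" => (finSumFinEquiv : Fin n₁ ⊕ Fin n₂ ≃ Fin (n₁ + n₂))
set_option quotPrecheck false in
/-- the local form matrix `(T₁ ⊗ F_v) ⊗ 1 ∈ M_{n₁}(E ⊗ F_v)` of `J₁`. -/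
local notation "H₁" => Matrix.map (localGram F n₁ T₁ v) (UnitaryGroup.toLocalRing E v)
set_option quotPrecheck false in
/-- the local form matrix `(T₂ ⊗ F_v) ⊗ 1` of `J₂`. -/
local notation "H₂" => Matrix.map (localGram F n₂ T₂ v) (UnitaryGroup.toLocalRing E v)
set_option quotPrecheck false in
/-- `ψ_v` is locally constant. -/
local notation "hlv" => isLocallyConstant_of_isContinuousNontrivial (isContinuousNontrivial_adeleAddCharAt F v)
set_option quotPrecheck false in
/-- `ψ_v` is continuous and non-trivial. -/
local notation "hψv" => isContinuousNontrivial_adeleAddCharAt F v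

/-! ## §0 The local Gram matrix of an orthogonal sum -/

/-- `(T₁ ⊕ᶠ T₂) ⊗ F_v = reindex (T₁ ⊗ F_v ⊕ T₂ ⊗ F_v)` (base change commutes with the block structure).
[cite: Kudla1984, §1] -/
theorem localGram_finSum :
    localGram F (n₁ + n₂) (UnitaryGroup.finSum n₁ n₂ T₁ T₂) v =
      Matrix.reindex eS eS (Matrix.fromBlocks (localGram F n₁ T₁ v) 0 0 (localGram F n₂ T₂ v)) := by
  change (UnitaryGroup.finSum n₁ n₂ T₁ T₂).map (algebraMap F Fv) = _
  rw [UnitaryGroup.finSum_map]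
  rfl

include hJ in
/-- **the local form matrix of `J = (T₁ ⊕ᶠ T₂) ⊗ 1` is `H₁ ⊕ᶠ H₂`**: `U(J)(F_v)` (matrix form) is the unitary group of
`finSum n₁ n₂ H₁ H₂`. [cite: Kudla1984, §1] -/
theorem local_sum_eq :
    UnitaryGroup.«local» E c (n₁ + n₂) J v =
      unitaryGroupOfForm (UnitaryGroup.conjLocal E c v) (UnitaryGroup.finSum n₁ n₂ H₁ H₂) := by
  rw [UnitaryGroup.«local», UnitaryGroup.localForm_eq_map E (n₁ + n₂) v (UnitaryGroup.finSum n₁ n₂ T₁ T₂) hJ]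
  change unitaryGroupOfForm _ ((localGram F (n₁ + n₂) (UnitaryGroup.finSum n₁ n₂ T₁ T₂) v).map _) = _
  rw [localGram_finSum, UnitaryGroup.finSum, UnitaryGroup.reindex_map, UnitaryGroup.fromBlocks_diag_map]

/-! ## §1 The block embeddings `g ↦ g ⊕ 1`, `g ↦ 1 ⊕ g` -/

/-- **`U(J₁)(F_v) →* U(J)(F_v)`, `g ↦ g ⊕ 1`, on the matrix forms.** [cite: Kudla1984, §1] -/
def inlLocal : UnitaryGroup.«local» E c n₁ J₁ v →* UnitaryGroup.«local» E c (n₁ + n₂) J v where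
  toFun g := ⟨UnitaryGroup.reindexGL eS (UnitaryGroup.blockDiagGL ((g : GL (Fin n₁) (UnitaryGroup.LocalRing E v)), 1)), by
    have hg : (g : GL (Fin n₁) (UnitaryGroup.LocalRing E v)) ∈ unitaryGroupOfForm (UnitaryGroup.conjLocal E c v) H₁ := by
      rw [← local_eq F E c v n₁ hJ₁]; exact g.2
    rw [local_sum_eq F E c v n₁ n₂ hJ, UnitaryGroup.finSum]
    exact (UnitaryGroup.reindexGL_mem_iff _ _ _ _).2 (UnitaryGroup.blockDiagGL_mem _ hg (one_mem _))⟩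
  map_one' := Subtype.ext (by
    change UnitaryGroup.reindexGL eS (UnitaryGroup.blockDiagGL
      ((((1 : UnitaryGroup.«local» E c n₁ J₁ v) : UnitaryGroup.«local» E c n₁ J₁ v) : GL (Fin n₁) (UnitaryGroup.LocalRing E v)), 1)) =
      (((1 : UnitaryGroup.«local» E c (n₁ + n₂) J v) : UnitaryGroup.«local» E c (n₁ + n₂) J v) :
        GL (Fin (n₁ + n₂)) (UnitaryGroup.LocalRing E v))
    rw [OneMemClass.coe_one, OneMemClass.coe_one, ← Prod.one_eq_mk, map_one, map_one])
  map_mul' g g' := Subtype.ext (by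
    change UnitaryGroup.reindexGL eS (UnitaryGroup.blockDiagGL
      (((g * g' : UnitaryGroup.«local» E c n₁ J₁ v) : GL (Fin n₁) (UnitaryGroup.LocalRing E v)), 1)) =
      UnitaryGroup.reindexGL eS (UnitaryGroup.blockDiagGL ((g : GL (Fin n₁) (UnitaryGroup.LocalRing E v)), 1)) *
        UnitaryGroup.reindexGL eS (UnitaryGroup.blockDiagGL ((g' : GL (Fin n₁) (UnitaryGroup.LocalRing E v)), 1))
    rw [Subgroup.coe_mul, ← map_mul, ← map_mul, Prod.mk_mul_mk, mul_one])

/-- matrix of `inlLocal g`: `reindex (g ⊕ 1)`. [cite: Kudla1984, §1] -/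
@[simp] theorem coe_inlLocal (g : UnitaryGroup.«local» E c n₁ J₁ v) :
    ((inlLocal F E c v n₁ n₂ hJ₁ hJ g : UnitaryGroup.«local» E c (n₁ + n₂) J v) : GL (Fin (n₁ + n₂)) (UnitaryGroup.LocalRing E v)) =
      UnitaryGroup.reindexGL eS (UnitaryGroup.blockDiagGL ((g : GL (Fin n₁) (UnitaryGroup.LocalRing E v)), 1)) :=
  rfl

/-- `inlLocal` is continuous. [cite: Kudla1984, §1] -/
theorem continuous_inlLocal : Continuous (inlLocal F E c v n₁ n₂ hJ₁ hJ) := by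
  refine Continuous.subtype_mk ?_ _
  exact (UnitaryGroup.continuous_reindexGL eS).comp
    (UnitaryGroup.continuous_blockDiagGL.comp (continuous_subtype_val.prodMk continuous_const))

/-- **`U(J₂)(F_v) →* U(J)(F_v)`, `g ↦ 1 ⊕ g`, on the matrix forms.** [cite: Kudla1984, §1] -/
def inrLocal : UnitaryGroup.«local» E c n₂ J₂ v →* UnitaryGroup.«local» E c (n₁ + n₂) J v where
  toFun g := ⟨UnitaryGroup.reindexGL eS (UnitaryGroup.blockDiagGL (1, (g : GL (Fin n₂) (UnitaryGroup.LocalRing E v)))), by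
    have hg : (g : GL (Fin n₂) (UnitaryGroup.LocalRing E v)) ∈ unitaryGroupOfForm (UnitaryGroup.conjLocal E c v) H₂ := by
      rw [← local_eq F E c v n₂ hJ₂]; exact g.2
    rw [local_sum_eq F E c v n₁ n₂ hJ, UnitaryGroup.finSum]
    exact (UnitaryGroup.reindexGL_mem_iff _ _ _ _).2 (UnitaryGroup.blockDiagGL_mem _ (one_mem _) hg)⟩
  map_one' := Subtype.ext (by
    change UnitaryGroup.reindexGL eS (UnitaryGroup.blockDiagGL
      (1, (((1 : UnitaryGroup.«local» E c n₂ J₂ v) : UnitaryGroup.«local» E c n₂ J₂ v) : GL (Fin n₂) (UnitaryGroup.LocalRing E v)))) =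
      (((1 : UnitaryGroup.«local» E c (n₁ + n₂) J v) : UnitaryGroup.«local» E c (n₁ + n₂) J v) :
        GL (Fin (n₁ + n₂)) (UnitaryGroup.LocalRing E v))
    rw [OneMemClass.coe_one, OneMemClass.coe_one, ← Prod.one_eq_mk, map_one, map_one])
  map_mul' g g' := Subtype.ext (by
    change UnitaryGroup.reindexGL eS (UnitaryGroup.blockDiagGL
      (1, ((g * g' : UnitaryGroup.«local» E c n₂ J₂ v) : GL (Fin n₂) (UnitaryGroup.LocalRing E v)))) =
      UnitaryGroup.reindexGL eS (UnitaryGroup.blockDiagGL (1, (g : GL (Fin n₂) (UnitaryGroup.LocalRing E v)))) *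
        UnitaryGroup.reindexGL eS (UnitaryGroup.blockDiagGL (1, (g' : GL (Fin n₂) (UnitaryGroup.LocalRing E v))))
    rw [Subgroup.coe_mul, ← map_mul, ← map_mul, Prod.mk_mul_mk, mul_one])

/-- matrix of `inrLocal g`: `reindex (1 ⊕ g)`. [cite: Kudla1984, §1] -/
@[simp] theorem coe_inrLocal (g : UnitaryGroup.«local» E c n₂ J₂ v) :
    ((inrLocal F E c v n₁ n₂ hJ₂ hJ g : UnitaryGroup.«local» E c (n₁ + n₂) J v) : GL (Fin (n₁ + n₂)) (UnitaryGroup.LocalRing E v)) =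
      UnitaryGroup.reindexGL eS (UnitaryGroup.blockDiagGL (1, (g : GL (Fin n₂) (UnitaryGroup.LocalRing E v)))) :=
  rfl

/-- `inrLocal` is continuous. [cite: Kudla1984, §1] -/
theorem continuous_inrLocal : Continuous (inrLocal F E c v n₁ n₂ hJ₂ hJ) := by
  refine Continuous.subtype_mk ?_ _
  exact (UnitaryGroup.continuous_reindexGL eS).comp
    (UnitaryGroup.continuous_blockDiagGL.comp (continuous_const.prodMk continuous_subtype_val))

/-- **`U(J₁)(F_v) →* U(J)(F_v)`, `g ↦ g ⊕ 1`, on the factor forms `localPi`.** [cite: Kudla1984, §1] -/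
def inlLoc : UnitaryGroup.localPi E c n₁ J₁ v →* UnitaryGroup.localPi E c (n₁ + n₂) J v :=
  ((UnitaryGroup.localPiEquiv E c (n₁ + n₂) J v).symm.toMonoidHom.comp (inlLocal F E c v n₁ n₂ hJ₁ hJ)).comp
    (UnitaryGroup.localPiEquiv E c n₁ J₁ v).toMonoidHom

/-- **`U(J₂)(F_v) →* U(J)(F_v)`, `g ↦ 1 ⊕ g`, on the factor forms `localPi`.** [cite: Kudla1984, §1] -/
def inrLoc : UnitaryGroup.localPi E c n₂ J₂ v →* UnitaryGroup.localPi E c (n₁ + n₂) J v :=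
  ((UnitaryGroup.localPiEquiv E c (n₁ + n₂) J v).symm.toMonoidHom.comp (inrLocal F E c v n₁ n₂ hJ₂ hJ)).comp
    (UnitaryGroup.localPiEquiv E c n₂ J₂ v).toMonoidHom

/-- unfolding: `localPiEquiv (inlLoc g) = inlLocal (localPiEquiv g)`. [cite: Kudla1984, §1] -/
theorem localPiEquiv_inlLoc (g : UnitaryGroup.localPi E c n₁ J₁ v) :
    UnitaryGroup.localPiEquiv E c (n₁ + n₂) J v (inlLoc F E c v n₁ n₂ hJ₁ hJ g) =
      inlLocal F E c v n₁ n₂ hJ₁ hJ (UnitaryGroup.localPiEquiv E c n₁ J₁ v g) := by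
  rw [inlLoc, MonoidHom.comp_apply, MonoidHom.comp_apply]
  exact (UnitaryGroup.localPiEquiv E c (n₁ + n₂) J v).apply_symm_apply _

/-- unfolding: `localPiEquiv (inrLoc g) = inrLocal (localPiEquiv g)`. [cite: Kudla1984, §1] -/
theorem localPiEquiv_inrLoc (g : UnitaryGroup.localPi E c n₂ J₂ v) :
    UnitaryGroup.localPiEquiv E c (n₁ + n₂) J v (inrLoc F E c v n₁ n₂ hJ₂ hJ g) =
      inrLocal F E c v n₁ n₂ hJ₂ hJ (UnitaryGroup.localPiEquiv E c n₂ J₂ v g) := by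
  rw [inrLoc, MonoidHom.comp_apply, MonoidHom.comp_apply]
  exact (UnitaryGroup.localPiEquiv E c (n₁ + n₂) J v).apply_symm_apply _

/-- `inlLoc` is continuous. [cite: Kudla1984, §1] -/
theorem continuous_inlLoc : Continuous (inlLoc F E c v n₁ n₂ hJ₁ hJ) :=
  ((UnitaryGroup.localPiEquiv E c (n₁ + n₂) J v).symm.continuous.comp (continuous_inlLocal F E c v n₁ n₂ hJ₁ hJ)).comp
    (UnitaryGroup.localPiEquiv E c n₁ J₁ v).continuous

/-- `inrLoc` is continuous. [cite: Kudla1984, §1] -/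
theorem continuous_inrLoc : Continuous (inrLoc F E c v n₁ n₂ hJ₂ hJ) :=
  ((UnitaryGroup.localPiEquiv E c (n₁ + n₂) J v).symm.continuous.comp (continuous_inrLocal F E c v n₁ n₂ hJ₂ hJ)).comp
    (UnitaryGroup.localPiEquiv E c n₂ J₂ v).continuous

/-- **components of `g ⊕ 1`**: `(inlLoc g)_w = reindex (g_w ⊕ 1)` in `GL_{n₁+n₂}(E_w)` for every `w ∣ v`.
[cite: Kudla1984, §1] -/
theorem inlLoc_apply (g : UnitaryGroup.localPi E c n₁ J₁ v) (w : UnitaryGroup.PlacesOver E v) :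
    ((inlLoc F E c v n₁ n₂ hJ₁ hJ g : UnitaryGroup.localPi E c (n₁ + n₂) J v) : UnitaryGroup.LocalGLPi E (n₁ + n₂) v) w =
      UnitaryGroup.reindexGL eS (UnitaryGroup.blockDiagGL ((g : UnitaryGroup.LocalGLPi E n₁ v) w, 1)) := by
  refine Units.ext ?_
  rw [show inlLoc F E c v n₁ n₂ hJ₁ hJ g = (UnitaryGroup.localPiEquiv E c (n₁ + n₂) J v).symm
      (inlLocal F E c v n₁ n₂ hJ₁ hJ (UnitaryGroup.localPiEquiv E c n₁ J₁ v g)) from rfl,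
    UnitaryGroup.coe_localPiEquiv_symm_apply, GLn.coe_piEquiv_apply, coe_inlLocal, UnitaryGroup.coe_reindexGL,
    UnitaryGroup.coe_blockDiagGL, UnitaryGroup.reindex_map, Matrix.fromBlocks_map, UnitaryGroup.coe_localPiEquiv_apply,
    GLn.map_piEquiv_symm, UnitaryGroup.coe_reindexGL, UnitaryGroup.coe_blockDiagGL, Units.val_one,
    Matrix.map_zero _ (map_zero _), Matrix.map_one _ (map_zero _) (map_one _)]
  rfl

/-- **components of `1 ⊕ g`**: `(inrLoc g)_w = reindex (1 ⊕ g_w)` in `GL_{n₁+n₂}(E_w)` for every `w ∣ v`.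
[cite: Kudla1984, §1] -/
theorem inrLoc_apply (g : UnitaryGroup.localPi E c n₂ J₂ v) (w : UnitaryGroup.PlacesOver E v) :
    ((inrLoc F E c v n₁ n₂ hJ₂ hJ g : UnitaryGroup.localPi E c (n₁ + n₂) J v) : UnitaryGroup.LocalGLPi E (n₁ + n₂) v) w =
      UnitaryGroup.reindexGL eS (UnitaryGroup.blockDiagGL (1, (g : UnitaryGroup.LocalGLPi E n₂ v) w)) := by
  refine Units.ext ?_
  rw [show inrLoc F E c v n₁ n₂ hJ₂ hJ g = (UnitaryGroup.localPiEquiv E c (n₁ + n₂) J v).symm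
      (inrLocal F E c v n₁ n₂ hJ₂ hJ (UnitaryGroup.localPiEquiv E c n₂ J₂ v g)) from rfl,
    UnitaryGroup.coe_localPiEquiv_symm_apply, GLn.coe_piEquiv_apply, coe_inrLocal, UnitaryGroup.coe_reindexGL,
    UnitaryGroup.coe_blockDiagGL, UnitaryGroup.reindex_map, Matrix.fromBlocks_map, UnitaryGroup.coe_localPiEquiv_apply,
    GLn.map_piEquiv_symm, UnitaryGroup.coe_reindexGL, UnitaryGroup.coe_blockDiagGL, Units.val_one,
    Matrix.map_zero _ (map_zero _), Matrix.map_one _ (map_zero _) (map_one _)]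
  rfl

/-- **the centre decomposes along the blocks**: the scalar `z · 1_{n₁+n₂}` is `(z · 1_{n₁}) ⊕ (z · 1_{n₂})`, i.e.
`localCenter (n₁ + n₂) J z = inlLoc (localCenter n₁ J₁ z) · inrLoc (localCenter n₂ J₂ z)`. [cite: Kudla1984, §1] -/
theorem localCenter_eq_inlLoc_mul_inrLoc {J' : Matrix (Fin 1) (Fin 1) E} (hJ' : J' 0 0 ≠ 0)
    (z : UnitaryGroup.localPi E c 1 J' v) :
    UnitaryGroup.localCenter E c (n₁ + n₂) J J' hJ' v z =
      inlLoc F E c v n₁ n₂ hJ₁ hJ (UnitaryGroup.localCenter E c n₁ J₁ J' hJ' v z) *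
        inrLoc F E c v n₁ n₂ hJ₂ hJ (UnitaryGroup.localCenter E c n₂ J₂ J' hJ' v z) := by
  refine Subtype.ext (funext fun w => Units.ext ?_)
  rw [UnitaryGroup.coe_localCenter, UnitaryGroup.coe_localScalarGL_apply, Subgroup.coe_mul, Pi.mul_apply, Units.val_mul,
    inlLoc_apply, inrLoc_apply, UnitaryGroup.coe_reindexGL, UnitaryGroup.coe_blockDiagGL, UnitaryGroup.coe_reindexGL,
    UnitaryGroup.coe_blockDiagGL, UnitaryGroup.coe_localCenter, UnitaryGroup.coe_localCenter,
    UnitaryGroup.coe_localScalarGL_apply, UnitaryGroup.coe_localScalarGL_apply, Units.val_one, Units.val_one,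
    Matrix.reindex_apply, Matrix.reindex_apply, Matrix.submatrix_mul_equiv, Matrix.fromBlocks_multiply]
  simp only [Matrix.mul_zero, Matrix.zero_mul, add_zero, zero_add, Matrix.mul_one, Matrix.one_mul]
  have key : ∀ a : w.1.adicCompletion E,
      (Matrix.fromBlocks (a • (1 : Matrix (Fin n₁) (Fin n₁) (w.1.adicCompletion E))) 0 0
          (a • (1 : Matrix (Fin n₂) (Fin n₂) (w.1.adicCompletion E)))).submatrix finSumFinEquiv.symm finSumFinEquiv.symm =
        a • (1 : Matrix (Fin (n₁ + n₂)) (Fin (n₁ + n₂)) (w.1.adicCompletion E)) := fun a => by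
    rw [show Matrix.fromBlocks (a • (1 : Matrix (Fin n₁) (Fin n₁) (w.1.adicCompletion E))) 0 0
        (a • (1 : Matrix (Fin n₂) (Fin n₂) (w.1.adicCompletion E))) = a • Matrix.fromBlocks 1 0 0 1 by
      rw [Matrix.fromBlocks_smul, smul_zero, smul_zero], Matrix.fromBlocks_one]
    ext i j
    simp only [Matrix.submatrix_apply, Matrix.smul_apply, Matrix.one_apply, EmbeddingLike.apply_eq_iff_eq]
  exact (key _).symm

/-- **the two blocks commute**: `(g₁ ⊕ 1)(1 ⊕ g₂) = (1 ⊕ g₂)(g₁ ⊕ 1)`. [cite: Kudla1984, §1] -/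
theorem inlLoc_mul_inrLoc_comm (g₁ : UnitaryGroup.localPi E c n₁ J₁ v) (g₂ : UnitaryGroup.localPi E c n₂ J₂ v) :
    inlLoc F E c v n₁ n₂ hJ₁ hJ g₁ * inrLoc F E c v n₁ n₂ hJ₂ hJ g₂ =
      inrLoc F E c v n₁ n₂ hJ₂ hJ g₂ * inlLoc F E c v n₁ n₂ hJ₁ hJ g₁ := by
  apply (UnitaryGroup.localPiEquiv E c (n₁ + n₂) J v).injective
  rw [map_mul, map_mul, localPiEquiv_inlLoc, localPiEquiv_inrLoc]
  refine Subtype.ext ?_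
  rw [Subgroup.coe_mul, Subgroup.coe_mul, coe_inlLocal, coe_inrLocal, ← map_mul, ← map_mul, ← map_mul, ← map_mul,
    Prod.mk_mul_mk, Prod.mk_mul_mk, one_mul, mul_one, one_mul, mul_one]

/-! ## §2 `ι_v (g ⊕ 1) = ι₁,v(g) ⊕ 1` and `ι_v (1 ⊕ g) = 1 ⊕ ι₂,v(g)` -/

variable [Algebra.IsQuadraticExtension F E] {δ : E} (hcδ : c δ = -δ) (hδ : δ ≠ 0) {d : F} (hd : δ * δ = algebraMap F E d)
  (hT₁ : T₁.IsSymm) (hT₂ : T₂.IsSymm) (hT₁d : IsUnit T₁.det) (hT₂d : IsUnit T₂.det)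

/-- **`1 ⊕ g₂` through `e` is the tree's `1 ⊕ g₂` (`UnitaryGroup.spSumEquiv 1 g₂`) conjugated by the relabelling
`UnitaryGroup.reindexW e`** — the right-hand analogue of `inlW_eq_reindexW_spSumEquiv`. [cite: Kudla1984, §1] -/
theorem inrW_eq_reindexW_spSumEquiv {K : Type*} [CommRing K] {ι₁ ι₂ ι : Type*} (e : ι₁ ⊕ ι₂ ≃ ι)
    (g₂ : ((ι₂ → K) × (ι₂ → K)) ≃ₗ[K] ((ι₂ → K) × (ι₂ → K))) :
    inrW e g₂ = ((UnitaryGroup.reindexW K e).symm.trans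
      (UnitaryGroup.spSumEquiv (1 : ((ι₁ → K) × (ι₁ → K)) ≃ₗ[K] ((ι₁ → K) × (ι₁ → K))) g₂)).trans
        (UnitaryGroup.reindexW K e) := by
  refine LinearEquiv.ext fun w => ?_
  obtain ⟨x, y⟩ := w
  rw [LinearEquiv.trans_apply, LinearEquiv.trans_apply, UnitaryGroup.reindexW_symm_apply, UnitaryGroup.spSumEquiv_apply,
    UnitaryGroup.reindexW_apply, inrW_apply, LinearEquiv.coe_one, id_eq]
  rfl

/-- **the embedding restricted to `U(J₁) × 1` is `spInl` of the embedding of `U(J₁)`**: `ι_v(g ⊕ 1) = ι₁,v(g) ⊕ 1`.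
[cite: Kudla1984, §1] -/
theorem iota_inlLoc (g : UnitaryGroup.localPi E c n₁ J₁ v) :
    iota F E c (n₁ + n₂) hcδ hδ hd (UnitaryGroup.finSum n₁ n₂ T₁ T₂) (UnitaryGroup.isSymm_finSum hT₁ hT₂) hJ v
        (inlLoc F E c v n₁ n₂ hJ₁ hJ g) =
      spInl eS (localGram F n₁ T₁ v) (localGram F n₂ T₂ v) (localGram_finSum F v n₁ n₂)
        (iota F E c n₁ hcδ hδ hd T₁ hT₁ hJ₁ v g) := by
  rw [iota_def, iota_def]
  refine Subtype.ext ?_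
  change (UnitaryGroup.isQuadraticCoordinates_local E v c hcδ hδ hd).resAut (Fin (n₁ + n₂))
      ((UnitaryGroup.localPiEquiv E c (n₁ + n₂) J v (inlLoc F E c v n₁ n₂ hJ₁ hJ g) : UnitaryGroup.«local» E c (n₁ + n₂) J v) :
        GL (Fin (n₁ + n₂)) (UnitaryGroup.LocalRing E v)) =
    inlW eS ((UnitaryGroup.isQuadraticCoordinates_local E v c hcδ hδ hd).resAut (Fin n₁)
      ((UnitaryGroup.localPiEquiv E c n₁ J₁ v g : UnitaryGroup.«local» E c n₁ J₁ v) : GL (Fin n₁) (UnitaryGroup.LocalRing E v)))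
  rw [localPiEquiv_inlLoc, coe_inlLocal, (UnitaryGroup.isQuadraticCoordinates_local E v c hcδ hδ hd).resAut_reindexGL,
    (UnitaryGroup.isQuadraticCoordinates_local E v c hcδ hδ hd).resAut_blockDiagGL, inlW_eq_reindexW_spSumEquiv]
  simp only [map_one]

/-- **the embedding restricted to `1 × U(J₂)` is `spInr` of the embedding of `U(J₂)`**: `ι_v(1 ⊕ g) = 1 ⊕ ι₂,v(g)`.
[cite: Kudla1984, §1] -/
theorem iota_inrLoc (g : UnitaryGroup.localPi E c n₂ J₂ v) :
    iota F E c (n₁ + n₂) hcδ hδ hd (UnitaryGroup.finSum n₁ n₂ T₁ T₂) (UnitaryGroup.isSymm_finSum hT₁ hT₂) hJ v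
        (inrLoc F E c v n₁ n₂ hJ₂ hJ g) =
      spInr eS (localGram F n₁ T₁ v) (localGram F n₂ T₂ v) (localGram_finSum F v n₁ n₂)
        (iota F E c n₂ hcδ hδ hd T₂ hT₂ hJ₂ v g) := by
  rw [iota_def, iota_def]
  refine Subtype.ext ?_
  change (UnitaryGroup.isQuadraticCoordinates_local E v c hcδ hδ hd).resAut (Fin (n₁ + n₂))
      ((UnitaryGroup.localPiEquiv E c (n₁ + n₂) J v (inrLoc F E c v n₁ n₂ hJ₂ hJ g) : UnitaryGroup.«local» E c (n₁ + n₂) J v) :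
        GL (Fin (n₁ + n₂)) (UnitaryGroup.LocalRing E v)) =
    inrW eS ((UnitaryGroup.isQuadraticCoordinates_local E v c hcδ hδ hd).resAut (Fin n₂)
      ((UnitaryGroup.localPiEquiv E c n₂ J₂ v g : UnitaryGroup.«local» E c n₂ J₂ v) : GL (Fin n₂) (UnitaryGroup.LocalRing E v)))
  rw [localPiEquiv_inrLoc, coe_inrLocal, (UnitaryGroup.isQuadraticCoordinates_local E v c hcδ hδ hd).resAut_reindexGL,
    (UnitaryGroup.isQuadraticCoordinates_local E v c hcδ hδ hd).resAut_blockDiagGL, inrW_eq_reindexW_spSumEquiv]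
  simp only [map_one]

/-! ## §3 Block restrictions of a section over `ι_v` -/

/-- `det (Tᵢ ⊗ F_v)` is a unit. [cite: Kudla1984, §1] -/
theorem isUnit_det_localGram {m : ℕ} {T₀ : Matrix (Fin m) (Fin m) F} (hT₀d : IsUnit T₀.det) :
    IsUnit (localGram F m T₀ v).det :=
  UnitaryGroup.isUnit_det_map (algebraMap F Fv) hT₀d

variable (s : UnitaryGroup.localPi E c (n₁ + n₂) J v →* LocalMp F (n₁ + n₂) (UnitaryGroup.finSum n₁ n₂ T₁ T₂) v)
  (hs : ∀ g, MpPsi.proj _ (s g) =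
    iota F E c (n₁ + n₂) hcδ hδ hd (UnitaryGroup.finSum n₁ n₂ T₁ T₂) (UnitaryGroup.isSymm_finSum hT₁ hT₂) hJ v g)

include hT₁ hT₂ hs in
/-- `s ∘ inlLoc` lies over `spInl ∘ ι₁,v`. [cite: Kudla1984, §1] -/
theorem proj_comp_inlLoc (g : UnitaryGroup.localPi E c n₁ J₁ v) :
    MpPsi.proj (schrodingerSB (Matrix.toLinearMap₂' Fv (localGram F (n₁ + n₂) (UnitaryGroup.finSum n₁ n₂ T₁ T₂) v))
        (adeleAddCharAt F v) hlv (continuous_toLinearMap₂'_left (localGram F (n₁ + n₂) (UnitaryGroup.finSum n₁ n₂ T₁ T₂) v)))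
      ((s.comp (inlLoc F E c v n₁ n₂ hJ₁ hJ)) g) =
      spInl eS (localGram F n₁ T₁ v) (localGram F n₂ T₂ v) (localGram_finSum F v n₁ n₂)
        (iota F E c n₁ hcδ hδ hd T₁ hT₁ hJ₁ v g) :=
  (hs (inlLoc F E c v n₁ n₂ hJ₁ hJ g)).trans (iota_inlLoc F E c v n₁ n₂ hJ₁ hJ hcδ hδ hd hT₁ hT₂ g)

include hT₁ hT₂ hs in
/-- `s ∘ inrLoc` lies over `spInr ∘ ι₂,v`. [cite: Kudla1984, §1] -/
theorem proj_comp_inrLoc (g : UnitaryGroup.localPi E c n₂ J₂ v) :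
    MpPsi.proj (schrodingerSB (Matrix.toLinearMap₂' Fv (localGram F (n₁ + n₂) (UnitaryGroup.finSum n₁ n₂ T₁ T₂) v))
        (adeleAddCharAt F v) hlv (continuous_toLinearMap₂'_left (localGram F (n₁ + n₂) (UnitaryGroup.finSum n₁ n₂ T₁ T₂) v)))
      ((s.comp (inrLoc F E c v n₁ n₂ hJ₂ hJ)) g) =
      spInr eS (localGram F n₁ T₁ v) (localGram F n₂ T₂ v) (localGram_finSum F v n₁ n₂)
        (iota F E c n₂ hcδ hδ hd T₂ hT₂ hJ₂ v g) :=
  (hs (inrLoc F E c v n₁ n₂ hJ₂ hJ g)).trans (iota_inrLoc F E c v n₁ n₂ hJ₂ hJ hcδ hδ hd hT₁ hT₂ g)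

/-- **LEFT BLOCK RESTRICTION**: `s : U(J)(F_v) →* S̃p(𝕎_v)` over `ι_v` restricts-and-strips to
`restrictLeft s : U(J₁)(F_v) →* S̃p(𝕎₁,v)`. [cite: MoeglinVignerasWaldspurger1987, Chap. 2 II.1 Rem. (6)] -/
def restrictLeft : UnitaryGroup.localPi E c n₁ J₁ v →* LocalMp F n₁ T₁ v :=
  undouble eS (localGram F n₁ T₁ v) (localGram F n₂ T₂ v) (localGram_finSum F v n₁ n₂)
    (isUnit_det_localGram F v hT₂d) hlv hψv (continuous_toLinearMap₂'_left (localGram F n₁ T₁ v))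
    (continuous_toLinearMap₂'_left (localGram F n₂ T₂ v))
    (continuous_toLinearMap₂'_left (localGram F (n₁ + n₂) (UnitaryGroup.finSum n₁ n₂ T₁ T₂) v))
    (iota F E c n₁ hcδ hδ hd T₁ hT₁ hJ₁ v) (s.comp (inlLoc F E c v n₁ n₂ hJ₁ hJ))
    (proj_comp_inlLoc F E c v n₁ n₂ hJ₁ hJ hcδ hδ hd hT₁ hT₂ s hs)

/-- **RIGHT BLOCK RESTRICTION**: `s : U(J)(F_v) →* S̃p(𝕎_v)` over `ι_v` restricts-and-strips to
`restrictRight s : U(J₂)(F_v) →* S̃p(𝕎₂,v)`. [cite: MoeglinVignerasWaldspurger1987, Chap. 2 II.1 Rem. (6)] -/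
def restrictRight : UnitaryGroup.localPi E c n₂ J₂ v →* LocalMp F n₂ T₂ v :=
  undoubleRight eS (localGram F n₁ T₁ v) (localGram F n₂ T₂ v) (localGram_finSum F v n₁ n₂)
    (isUnit_det_localGram F v hT₁d) hlv hψv (continuous_toLinearMap₂'_left (localGram F n₁ T₁ v))
    (continuous_toLinearMap₂'_left (localGram F n₂ T₂ v))
    (continuous_toLinearMap₂'_left (localGram F (n₁ + n₂) (UnitaryGroup.finSum n₁ n₂ T₁ T₂) v))
    (iota F E c n₂ hcδ hδ hd T₂ hT₂ hJ₂ v) (s.comp (inrLoc F E c v n₁ n₂ hJ₂ hJ))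
    (proj_comp_inrLoc F E c v n₁ n₂ hJ₂ hJ hcδ hδ hd hT₁ hT₂ s hs)

/-- **`restrictLeft s` lies over `ι₁,v`.** [cite: MoeglinVignerasWaldspurger1987, Chap. 2 II.1 Rem. (6)] -/
theorem proj_restrictLeft (g : UnitaryGroup.localPi E c n₁ J₁ v) :
    MpPsi.proj _ (restrictLeft F E c v n₁ n₂ hJ₁ hJ hcδ hδ hd hT₁ hT₂ hT₂d s hs g) = iota F E c n₁ hcδ hδ hd T₁ hT₁ hJ₁ v g :=
  proj_undouble eS (localGram F n₁ T₁ v) (localGram F n₂ T₂ v) (localGram_finSum F v n₁ n₂)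
    (isUnit_det_localGram F v hT₂d) hlv hψv (continuous_toLinearMap₂'_left (localGram F n₁ T₁ v))
    (continuous_toLinearMap₂'_left (localGram F n₂ T₂ v))
    (continuous_toLinearMap₂'_left (localGram F (n₁ + n₂) (UnitaryGroup.finSum n₁ n₂ T₁ T₂) v))
    (iota F E c n₁ hcδ hδ hd T₁ hT₁ hJ₁ v) (s.comp (inlLoc F E c v n₁ n₂ hJ₁ hJ))
    (proj_comp_inlLoc F E c v n₁ n₂ hJ₁ hJ hcδ hδ hd hT₁ hT₂ s hs) g

/-- **`restrictRight s` lies over `ι₂,v`.** [cite: MoeglinVignerasWaldspurger1987, Chap. 2 II.1 Rem. (6)] -/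
theorem proj_restrictRight (g : UnitaryGroup.localPi E c n₂ J₂ v) :
    MpPsi.proj _ (restrictRight F E c v n₁ n₂ hJ₂ hJ hcδ hδ hd hT₁ hT₂ hT₁d s hs g) = iota F E c n₂ hcδ hδ hd T₂ hT₂ hJ₂ v g :=
  proj_undoubleRight eS (localGram F n₁ T₁ v) (localGram F n₂ T₂ v) (localGram_finSum F v n₁ n₂)
    (isUnit_det_localGram F v hT₁d) hlv hψv (continuous_toLinearMap₂'_left (localGram F n₁ T₁ v))
    (continuous_toLinearMap₂'_left (localGram F n₂ T₂ v))
    (continuous_toLinearMap₂'_left (localGram F (n₁ + n₂) (UnitaryGroup.finSum n₁ n₂ T₁ T₂) v))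
    (iota F E c n₂ hcδ hδ hd T₂ hT₂ hJ₂ v) (s.comp (inrLoc F E c v n₁ n₂ hJ₂ hJ))
    (proj_comp_inrLoc F E c v n₁ n₂ hJ₂ hJ hcδ hδ hd hT₁ hT₂ s hs) g

/-- **`ω(s(g₁ ⊕ 1))(f₁ ⊠ f₂) = ω(restrictLeft s g₁) f₁ ⊠ f₂`.** [cite: MoeglinVignerasWaldspurger1987, Chap. 2 II.1 Rem. (6)] -/
theorem toRep_inlLoc_boxSB (g : UnitaryGroup.localPi E c n₁ J₁ v) (f₁ : SchwartzBruhat (Fin n₁ → Fv))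
    (f₂ : SchwartzBruhat (Fin n₂ → Fv)) :
    MpPsi.toRep (localSchrodinger F (n₁ + n₂) (UnitaryGroup.finSum n₁ n₂ T₁ T₂) v) (s (inlLoc F E c v n₁ n₂ hJ₁ hJ g))
        (boxSB Fv eS f₁ f₂) =
      boxSB Fv eS (MpPsi.toRep (localSchrodinger F n₁ T₁ v)
        (restrictLeft F E c v n₁ n₂ hJ₁ hJ hcδ hδ hd hT₁ hT₂ hT₂d s hs g) f₁) f₂ :=
  toRep_apply_boxSB_undouble eS (localGram F n₁ T₁ v) (localGram F n₂ T₂ v) (localGram_finSum F v n₁ n₂)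
    (isUnit_det_localGram F v hT₂d) hlv hψv (continuous_toLinearMap₂'_left (localGram F n₁ T₁ v))
    (continuous_toLinearMap₂'_left (localGram F n₂ T₂ v))
    (continuous_toLinearMap₂'_left (localGram F (n₁ + n₂) (UnitaryGroup.finSum n₁ n₂ T₁ T₂) v))
    (iota F E c n₁ hcδ hδ hd T₁ hT₁ hJ₁ v) (s.comp (inlLoc F E c v n₁ n₂ hJ₁ hJ))
    (proj_comp_inlLoc F E c v n₁ n₂ hJ₁ hJ hcδ hδ hd hT₁ hT₂ s hs) g f₁ f₂

/-- **`ω(s(1 ⊕ g₂))(f₁ ⊠ f₂) = f₁ ⊠ ω(restrictRight s g₂) f₂`.** [cite: MoeglinVignerasWaldspurger1987, Chap. 2 II.1 Rem. (6)] -/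
theorem toRep_inrLoc_boxSB (g : UnitaryGroup.localPi E c n₂ J₂ v) (f₁ : SchwartzBruhat (Fin n₁ → Fv))
    (f₂ : SchwartzBruhat (Fin n₂ → Fv)) :
    MpPsi.toRep (localSchrodinger F (n₁ + n₂) (UnitaryGroup.finSum n₁ n₂ T₁ T₂) v) (s (inrLoc F E c v n₁ n₂ hJ₂ hJ g))
        (boxSB Fv eS f₁ f₂) =
      boxSB Fv eS f₁ (MpPsi.toRep (localSchrodinger F n₂ T₂ v)
        (restrictRight F E c v n₁ n₂ hJ₂ hJ hcδ hδ hd hT₁ hT₂ hT₁d s hs g) f₂) :=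
  toRep_apply_boxSB_undoubleRight eS (localGram F n₁ T₁ v) (localGram F n₂ T₂ v) (localGram_finSum F v n₁ n₂)
    (isUnit_det_localGram F v hT₁d) hlv hψv (continuous_toLinearMap₂'_left (localGram F n₁ T₁ v))
    (continuous_toLinearMap₂'_left (localGram F n₂ T₂ v))
    (continuous_toLinearMap₂'_left (localGram F (n₁ + n₂) (UnitaryGroup.finSum n₁ n₂ T₁ T₂) v))
    (iota F E c n₂ hcδ hδ hd T₂ hT₂ hJ₂ v) (s.comp (inrLoc F E c v n₁ n₂ hJ₂ hJ))
    (proj_comp_inrLoc F E c v n₁ n₂ hJ₂ hJ hcδ hδ hd hT₁ hT₂ s hs) g f₁ f₂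

/-- **THE OSCILLATOR REPRESENTATION OF `U(V₁ ⊥ V₂)` RESTRICTED TO `U(V₁) × U(V₂)` IS THE OUTER TENSOR PRODUCT**:
`ω(s((g₁ ⊕ 1)(1 ⊕ g₂)))(f₁ ⊠ f₂) = ω(restrictLeft s g₁) f₁ ⊠ ω(restrictRight s g₂) f₂`.
[cite: MoeglinVignerasWaldspurger1987, Chap. 2 II.1 Rem. (6)] -/
theorem toRep_inlLoc_mul_inrLoc_boxSB (g₁ : UnitaryGroup.localPi E c n₁ J₁ v) (g₂ : UnitaryGroup.localPi E c n₂ J₂ v)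
    (f₁ : SchwartzBruhat (Fin n₁ → Fv)) (f₂ : SchwartzBruhat (Fin n₂ → Fv)) :
    MpPsi.toRep (localSchrodinger F (n₁ + n₂) (UnitaryGroup.finSum n₁ n₂ T₁ T₂) v)
        (s (inlLoc F E c v n₁ n₂ hJ₁ hJ g₁ * inrLoc F E c v n₁ n₂ hJ₂ hJ g₂)) (boxSB Fv eS f₁ f₂) =
      boxSB Fv eS
        (MpPsi.toRep (localSchrodinger F n₁ T₁ v) (restrictLeft F E c v n₁ n₂ hJ₁ hJ hcδ hδ hd hT₁ hT₂ hT₂d s hs g₁) f₁)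
        (MpPsi.toRep (localSchrodinger F n₂ T₂ v) (restrictRight F E c v n₁ n₂ hJ₂ hJ hcδ hδ hd hT₁ hT₂ hT₁d s hs g₂) f₂) := by
  have h1 := LinearMap.congr_fun ((MpPsi.toRep (localSchrodinger F (n₁ + n₂) (UnitaryGroup.finSum n₁ n₂ T₁ T₂) v)).map_mul
    (s (inlLoc F E c v n₁ n₂ hJ₁ hJ g₁)) (s (inrLoc F E c v n₁ n₂ hJ₂ hJ g₂))) (boxSB Fv eS f₁ f₂)
  have h0 : s (inlLoc F E c v n₁ n₂ hJ₁ hJ g₁ * inrLoc F E c v n₁ n₂ hJ₂ hJ g₂) =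
      s (inlLoc F E c v n₁ n₂ hJ₁ hJ g₁) * s (inrLoc F E c v n₁ n₂ hJ₂ hJ g₂) := s.map_mul _ _
  rw [h0]
  refine h1.trans ?_
  simp only [Module.End.mul_apply, toRep_inrLoc_boxSB F E c v n₁ n₂ hJ₂ hJ hcδ hδ hd hT₁ hT₂ hT₁d s hs,
    toRep_inlLoc_boxSB F E c v n₁ n₂ hJ₁ hJ hcδ hδ hd hT₁ hT₂ hT₂d s hs]

/-! ## §4 Smoothness transfers to the blocks -/

include hs in
/-- **smoothness transfers to the left block**: if `ω_s` is smooth then `ω_{restrictLeft s}` is smooth (the stabiliser of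
`f₁` contains the preimage under the continuous `inlLoc` of the stabiliser of `f₁ ⊠ f₂`, `f₂ ≠ 0`).
[cite: MoeglinVignerasWaldspurger1987, Chap. 2 II.8] -/
theorem isSmooth_restrictLeft
    (hsm : Representation.IsSmooth
      ((MpPsi.toRep (localSchrodinger F (n₁ + n₂) (UnitaryGroup.finSum n₁ n₂ T₁ T₂) v)).comp s)) :
    Representation.IsSmooth ((MpPsi.toRep (localSchrodinger F n₁ T₁ v)).comp
      (restrictLeft F E c v n₁ n₂ hJ₁ hJ hcδ hδ hd hT₁ hT₂ hT₂d s hs)) := by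
  intro f₁
  obtain ⟨f₂, hf₂⟩ := exists_schwartzBruhat_pi_ne_zero Fv (Fin n₂)
  have hopen := hsm (boxSB Fv eS f₁ f₂)
  rw [Representation.isSmoothVector_iff] at hopen ⊢
  -- the stabiliser contains the open preimage of the stabiliser of `f₁ ⊠ f₂`
  have hsub : (Representation.stabilizerSubgroup
      ((MpPsi.toRep (localSchrodinger F (n₁ + n₂) (UnitaryGroup.finSum n₁ n₂ T₁ T₂) v)).comp s) (boxSB Fv eS f₁ f₂)).comap
      (inlLoc F E c v n₁ n₂ hJ₁ hJ) ≤
      Representation.stabilizerSubgroup ((MpPsi.toRep (localSchrodinger F n₁ T₁ v)).comp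
        (restrictLeft F E c v n₁ n₂ hJ₁ hJ hcδ hδ hd hT₁ hT₂ hT₂d s hs)) f₁ := by
    intro k hk
    rw [Subgroup.mem_comap] at hk
    change MpPsi.toRep (localSchrodinger F n₁ T₁ v) (restrictLeft F E c v n₁ n₂ hJ₁ hJ hcδ hδ hd hT₁ hT₂ hT₂d s hs k) f₁ = f₁
    refine boxSB_left_cancel Fv eS hf₂ ?_
    rw [← toRep_inlLoc_boxSB]
    exact hk
  exact Subgroup.isOpen_mono hsub (hopen.preimage (continuous_inlLoc F E c v n₁ n₂ hJ₁ hJ))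

include hs in
/-- **smoothness transfers to the right block**: if `ω_s` is smooth then `ω_{restrictRight s}` is smooth.
[cite: MoeglinVignerasWaldspurger1987, Chap. 2 II.8] -/
theorem isSmooth_restrictRight
    (hsm : Representation.IsSmooth
      ((MpPsi.toRep (localSchrodinger F (n₁ + n₂) (UnitaryGroup.finSum n₁ n₂ T₁ T₂) v)).comp s)) :
    Representation.IsSmooth ((MpPsi.toRep (localSchrodinger F n₂ T₂ v)).comp
      (restrictRight F E c v n₁ n₂ hJ₂ hJ hcδ hδ hd hT₁ hT₂ hT₁d s hs)) := by
  intro f₂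
  obtain ⟨f₁, hf₁⟩ := exists_schwartzBruhat_pi_ne_zero Fv (Fin n₁)
  have hopen := hsm (boxSB Fv eS f₁ f₂)
  rw [Representation.isSmoothVector_iff] at hopen ⊢
  have hsub : (Representation.stabilizerSubgroup
      ((MpPsi.toRep (localSchrodinger F (n₁ + n₂) (UnitaryGroup.finSum n₁ n₂ T₁ T₂) v)).comp s) (boxSB Fv eS f₁ f₂)).comap
      (inrLoc F E c v n₁ n₂ hJ₂ hJ) ≤
      Representation.stabilizerSubgroup ((MpPsi.toRep (localSchrodinger F n₂ T₂ v)).comp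
        (restrictRight F E c v n₁ n₂ hJ₂ hJ hcδ hδ hd hT₁ hT₂ hT₁d s hs)) f₂ := by
    intro k hk
    rw [Subgroup.mem_comap] at hk
    change MpPsi.toRep (localSchrodinger F n₂ T₂ v) (restrictRight F E c v n₁ n₂ hJ₂ hJ hcδ hδ hd hT₁ hT₂ hT₁d s hs k) f₂ = f₂
    refine boxSB_right_cancel Fv eS hf₁ ?_
    rw [← toRep_inrLoc_boxSB]
    exact hk
  exact Subgroup.isOpen_mono hsub (hopen.preimage (continuous_inrLoc F E c v n₁ n₂ hJ₂ hJ))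

end BlockSum

end Literature.NumberTheory.GelbartRogawski1991.UnitaryDualPair.LocalSplitting

end
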